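import Literature.MathematicalPhysics.QuantumFieldTheory.Balaban1983to89.B9Cor35GpAtCubeLetters
import Literature.MathematicalPhysics.QuantumFieldTheory.Balaban1983to89.B9CubeDirichletLetterDerivAtOne
import Literature.MathematicalPhysics.QuantumFieldTheory.Balaban1983to89.Node00.OpsYCubeDirInverse

/-!
# `Balaban1983to89.B9Cor35GpDirInputsAtOne` — [Balaban1985BackgroundPropagators] Corollary 3.5 p. 407 («for U = 1 these theorems are proved in [4]»)
# FOR PRINT's DIRICHLET CUBE LETTER `G′_□ = (Ω₀Δ′_{a,□}Ω₀)⁻¹` OF p. 394 ∕ pp. 408–409 (road P4): THE `U = 1` BINDERS OF `B9Thm34SectBUniformR1.thm34_Gp_uniform`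
# AT THE CUBE GEOMETRY `geoCK i □` — the PADDED letters `Δp = conj b(η⁻²·padΔ_{□,Ω₀}(1))`, `Gp = conj b(η²·(padΔ_{□,Ω₀}(1))⁻¹)` and their unit laws,
# the real kernel `GpDirPadW = 𝟙G′_□(1)𝟙 + (1 − 𝟙)` of `Gp`, and THEOREM 3.1 (3.42)₁₋₃ AT `U = 1` FOR IT IN ALL FIVE ORIENTATIONS AT ONE RATE
# (`thm31_dir_allOrientations`) from g31's signed-image tables — r05's FILE 5b `B9Cor35GpCubeInputsAtOne` + FILE 6 §1 RE-PRESSED AT THE DIRICHLET LETTER,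
# par-generic (`par 1 = 1`) — sub-row G-B9-LETTERS (site sector), seat dag-n06-c g32 UNIT 1

statement-level skeleton of published theorems with citation tags; proofs where landed; nothing here is a claim about the Yang–Mills mass gap

CITATION HEADER (lean-in-tree rule).  B9 = T. Bałaban, *Propagators for lattice gauge theories in a background field*, Commun. Math. Phys. **99** (1985)
389–434 [Balaban1985BackgroundPropagators] (held `paper:balaban1985-cmp99-background-propagators`; journal page = PDF page + 388): p. 394 l. 24–33 «we consider
the operator Δ′_a with Dirichlet boundary conditions on ∂Ω₀, i.e. the operator Δ′_a↾Ω₀ = Ω₀Δ′_aΩ₀ … Its inverse is denoted by G′, or G′(U)»; p. 408 (last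
lines)–p. 409 l. 5 «For n ≧ 0 we have dist(Ω₀(□)ᶜ, □⁴) < 2R₀M₀Lʲη, hence Ω₀(□) ⊂ □⁵ … the sequence {Ω_n(□)} satisfies the assumptions of Corollary 3.6.
The operators constructed for this sequence, which we denote by G′_□(U), … satisfy all the inequalities of Theorems 3.1–3.3»; Cor. 3.5 p. 407 l. 26–31
«with U = 1, these theorems were proved in [4]»; Thm 3.1 (3.42) p. 397; (3.3) p. 390, (3.8) p. 392; (3.24)–(3.25) pp. 394–395; p. 398 (scale transfer);
p. 399 l. 1–3.  [4] = [Balaban1984PropagatorsII] Prop. 2.2 (2.67) p. 234, (2.51)–(2.55) pp. 232–233, (2.61)–(2.65) p. 234.  [Balaban1983RegularityDecay]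
(2.42) p. 584 (Dirichlet Green's functions by images).  Rows B9.Thm3.1 × B9.Cor3.5 (cells only; no row head changes).

WHY THIS FILE (road P4 of the N06 h36b campaign: PRINT's Dirichlet cube letter instead of r05's torus-levelled `GpCubeY`; dag-n06-c g31 LOCATED-31, def-Y g38
word, dag-n06-d g32 (T-□)).  Sect. B's engine `thm34_Gp_uniform` (Theorem 3.4 ∕ Cor. 3.5 at `U = 1`) wants letters `Δp`, `Gp` on the WHOLE site space with
`Δp·Gp = 1 = Gp·Δp` and Theorem 3.1 (3.42)₁₋₃ for `Gp` for all `k : κ ⊕ κ`.  For the Dirichlet letter the honest pair is the PADDED one: def-Y's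
`padDeltaCubeY i □ par Ω₀(□) 1 = Ω₀Δ′_{a,□}(1)Ω₀ + (1 − Ω₀)` (`Node00.OpsYCubeDirInverse`, «E») and its `Ring.inverse`, whose compression `Ω₀·(·)·Ω₀` IS
def-Y's `G′_□(1) = GpDirY i □ par Ω₀(□) 1` (`GpDirY_def`).  At `U = 1` the inverse is the lift of the real kernel `GpDirPadW = 𝟙·GpDirOne·𝟙 + (1 − 𝟙)`
(`GpDirOne` = g31's `B9CubeDirichletLetterAtOne`, the signed-image Dirichlet kernel on `Ω₀(□) = dirDomC`), so Theorem 3.1 for `Gp` splits into g31's three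
printed tables for `GpDirOne` (`hasMajorant_GpDirOne`, `hasMajorant_dT_GpDirOne`, `hasMajorant_GpDirOne_dTt`), the two shift-derived orientations (r05 FILE 5b
§5, here for a generic matrix), and the EXTERIOR ROWS `1 − 𝟙_{Ω₀}` and their one-step products — diagonal ∕ nearest-neighbour operators dominated pointwise,
hence with block majorants `2e^{δ}·w·e^{−δd}` for any weight `w ≥ 1` (no geometry of `Ω₀(□)` enters).  This is r05's FILE 5b + FILE 6 §1 for the new letter;
FILE 6 §2 (`cor35_Gp_cube`) is UNIT 2 (`B9Cor35GpDirAtCubeLetters`).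

WHAT IS PROVED (3 `def`s with bodies — `GpDirPadW`, `DpDirK`, `GpDirK`; 2 `abbrev`s — `dirDomY`, `GpDirOneY`; 0 sorry; 0 new named facts; standard axioms):
* §1 (generic letter `conj b T`, `T(f ⊗ E) = (η²Mf) ⊗ E`): ★`h342_1_of_liftY`, ★`h342_2_inl_of_liftY`, ★`h342_3_inr_of_liftY`, `h342_2_inr_of_liftY`,
  `h342_3_inl_of_liftY` (FILE 5b §4 for any real matrix `M`, hypotheses over `toB6 (geoCK i □)`), `hasMajorant_transpose_dT_mul`, `hasMajorant_mul_dT`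
  (FILE 5b §5 for any `M`);
* §2 `dirDomY`, `GpDirOneY`, `GpDirPadW`, `DpDirK`, `GpDirK`, ★`isUnit_padDeltaCubeY_one_dirDomY` (E's `isUnit_padDeltaCubeY_one` fed by g31's
  `compress_mul_GpDirOneY`), ★★`DpDirK_mul_GpDirK` (binders `hΔpGp`, `hGpΔp`), ★`ringInverse_padDeltaCubeY_one_eq_liftOpY`
  (`(padΔ(1))⁻¹ = GpDirPadW♯`), `smul_ringInverse_padDeltaCubeY_one_liftY` (the `hT` clause of §1 for `GpDirK`), `compr_GpDirOneY`, ★`GpDirPadW_eq_add`,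
  `GpDirY_one_eq_liftOpY_GpDirOneY` (def-Y's `G′_□(1) = GpDirOne♯`);
* §3 ★`hasMajorant_of_pointwise_le` (pointwise domination one stencil step away ⇒ block majorant), `abs_compl_mulVec_le`, `shiftMat_mul_mulVec`,
  `abs_compl_mul_shiftMat_mulVec_le`, `transpose_dT`, `tshift_unitVec_eq`, ★`hasMajorant_compl`, `hasMajorant_sub_two`, ★`hasMajorant_dT_mul_compl`,
  ★`hasMajorant_compl_mul_transpose_dT`, ★`hasMajorant_transpose_dT_mul_compl`, ★`hasMajorant_compl_mul_dT`;
* §4 ★★★`thm31_dir_allOrientations` — `∃ δ₁ C₁ M₀ T₀ N₀` (functions of `d, L`) with, above `M₀ ≤ L·M_h`, `N₀ + 1 ≤ R·L·M_h`, `T₀ ≤ R·L·M_h − 1`, for every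
  cover cube and every `Rr, H`: `GpDirPadW ≺ C₁L^{2n}e^{−δ₁d}`, `∂_μ·GpDirPadW`, `GpDirPadW·∂_μᵀ`, `∂_μᵀ·GpDirPadW`, `GpDirPadW·∂_μ ≺ C₁Lⁿe^{−δ₁d}` over
  `toB6 (geoCK i □) Rr H` (r05 FILE 6 §1's merge VERBATIM for the interior kernel, plus §3).

PROOF.  Ours (bookkeeping over certified inputs).  Print's Cor. 3.5 defers `U = 1` to [4]; [4]'s Prop. 2.2 for the Dirichlet kernel is g31's image fold of
[Balaban1983RegularityDecay] (2.42); the exterior rows of the padded inverse are the identity.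

HONEST SCOPE / NOT CLAIMED.  `U = 1` only; the padded letter is an artefact of the engine's whole-space formulation (its `Ω₀`-compression is print's `G′_□(1)`);
the (3.43) Hölder and (3.46)–(3.47) entries are not touched; the (3.42)₄ Laplacian table (g31's `hasMajorant_perLapT_GpDirOne`) is not merged here (the engine
does not take it); rates degrade by the (2.54)/(2.63) bookkeeping factors (∃-constants downstream); the transporter clause `par 1 = 1` is displayed — at `U ≠ 1`
road P4 needs a cube-level-keyed knit table (`parKnitCubeY □`, not in the tree; dag-n06-d g32 (T-□), this seat's word (β)); nothing on `d = 4`, the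
continuum, reflection positivity or the mass gap; NOT a node discharge; no row head changes.

RELATED IN THE TREE, NOT DUPLICATED: r05's `B9Cor35GpCubeInputsAtOne` (same binders for the torus-levelled letter `GpCubeY`; its §1/§3/§5 lemmas are IMPORTED and
used, its §4 is re-pressed generically in §1 here), `B9Cor35GpAtCubeLetters.thm31_cube_allOrientations` (the merge this §4 twins); def-Y's E (letters, used by
name); g31's `B9CubeDirichletLetterAtOne/DerivAtOne` (the tables, used by name); n06-c's member-level `B9SectBGpLettersY` (other letter).
-/

noncomputable section

namespace Literature.MathematicalPhysics.QuantumFieldTheory.Balaban1983to89.B9Cor35GpDirInputsAtOne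

open Literature.MathematicalPhysics.QuantumFieldTheory.Balaban1983to89
open Literature.MathematicalPhysics.QuantumFieldTheory.Balaban1983to89.B6RandomWalk (HasMajorant BlockSupp hasMajorant_mono hasMajorant_add Triangle254 Ineq261
  c1_nonneg)
open Literature.MathematicalPhysics.QuantumFieldTheory.Balaban1983to89.B9Thm34Ext (toB6)
open Literature.MathematicalPhysics.QuantumFieldTheory.Balaban1983to89.B9Eq352DivFormLetters (conj conj_apply coordEquiv conj_neg gradLetterF gradLetterB)
open Literature.MathematicalPhysics.QuantumFieldTheory.Balaban1983to89.B9Eq352GradLetters (diffLetter diffLetter_inl diffLetter_inr)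
open Literature.MathematicalPhysics.QuantumFieldTheory.Balaban1983to89.B6KLevelCensusIndexV1 (KIdx kGeo)
open Literature.MathematicalPhysics.QuantumFieldTheory.Balaban1983to89.B6Cover236MultiLevelBlocks (cubes)
open Literature.MathematicalPhysics.QuantumFieldTheory.Balaban1983to89.B6MultiLevelTorusOperator (tshift tshift_symm_apply unitVec shiftMat shiftMat_mulVec
  shiftMat_neg)
open Literature.MathematicalPhysics.QuantumFieldTheory.Balaban1983to89.B6Prop22DerivMultiLevelTorus (dT dT_mulVec)
open Literature.MathematicalPhysics.QuantumFieldTheory.Balaban1983to89.B9Thm31CubeLocalFlat (wCube)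
open Literature.MathematicalPhysics.QuantumFieldTheory.Balaban1983to89.B9CubeLettersOpsL0 (oddMh cubeFamY)
open Literature.MathematicalPhysics.QuantumFieldTheory.Balaban1983to89.B9CubeLettersBondOpsL0 (BlkCubeY)
open Literature.MathematicalPhysics.QuantumFieldTheory.Balaban1983to89.B9Eq360DeltaPrimeACubeY (blkCubeY)
open Literature.MathematicalPhysics.QuantumFieldTheory.Balaban1983to89.B9CubeGeometryInputs (geoCK geoCK_len geoCK_eta geoCK_eta_pos geoCK_dist
  geoCK_dist_axioms geoCK_len_pos RM1 N1 exists_h261_geoCK hST_geoCK stencil_geoCK)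
open Literature.MathematicalPhysics.QuantumFieldTheory.Balaban1983to89.B9Cor35GpCubeInputsAtOne (liftY_smul liftY_neg hasMajorant_conj_of_liftY hasMajorant_smul
  hasMajorant_neg eta_ne_zero conj_one' hasMajorant_toB6_of_geomT gradLetterF_one_liftY gradLetterB_one_liftY len_reshape hasMajorant_shiftMat
  toLin'_transpose_dT_mul toLin'_mul_dT hasMajorant_shift_mul_weighted transfer_pow_of_scaleTransfer)
open Literature.MathematicalPhysics.QuantumFieldTheory.Balaban1983to89.B9Cor35GpAtCubeLetters (hasMajorant_weaken)
open Literature.MathematicalPhysics.QuantumFieldTheory.Balaban1983to89.B9CubeSequence408Mirrors (dirDomC)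
open Literature.MathematicalPhysics.QuantumFieldTheory.Balaban1983to89.B9CubeDirichletLetterAtOne (GpDirOne GpDirOne_apply_of_not_mem_left
  GpDirOne_apply_of_not_mem_right compress_mul_GpDirOneY hasMajorant_GpDirOne)
open Literature.MathematicalPhysics.QuantumFieldTheory.Balaban1983to89.B9CubeDirichletLetterDerivAtOne (hasMajorant_dT_GpDirOne hasMajorant_GpDirOne_dTt)
open Literature.MathematicalPhysics.QuantumFieldTheory.Balaban1983to89.Node00 (SiteY CfgY SiteParY toKT shiftY liftY liftY_apply liftOpY liftOpY_liftY)
open Literature.MathematicalPhysics.QuantumFieldTheory.Balaban1983to89.Node00.OpsYLocalInverse (dirPadY)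
open Literature.MathematicalPhysics.QuantumFieldTheory.Balaban1983to89.Node00.OpsYCubeDirInverse (dirPadY_mul_dirPadY_eq_one indDiagY indDiagY_apply
  indDiagY_mul_indDiagY indDiagY_mulVec_apply compr_apply compr_mul_compr_eq_indDiagY padDeltaCubeY GpDirY padDeltaCubeY_one_liftY isUnit_padDeltaCubeY_one
  GpDirY_one_eq_liftOpY)
open Literature.MathematicalPhysics.QuantumFieldTheory.Balaban1983to89.B9Cor35AtOneInverseLetters (eq_liftOpY_of_ringInverse)
open scoped Matrix

variable {d ℓ : ℕ} {hd : 1 ≤ d + 1} {hL : Odd (ℓ + 1) ∧ 1 < ℓ + 1} {b₀ b₁ : ℝ}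

/-! ## §1  The (3.42)₁₋₃ binders of `thm34_Gp_uniform` for ANY letter `Gp = conj b T` whose `T` acts on `f ⊗ E` through a real matrix `η²·M` -/

section Generic

variable {𝔸 : Type} [NormedRing 𝔸] [NormedAlgebra ℂ 𝔸]
variable {ι : Type} [Fintype ι] (b : Module.Basis ι ℝ 𝔸)
variable (i : KIdx d ℓ hd hL b₀ b₁) (c : ↥(cubes (toKT i).D.toDomains))
variable {T : Module.End ℝ (SiteY i → 𝔸)} {M : Matrix (SiteY i) (SiteY i) ℝ}

/-- ★ **BINDER `h342_1` FOR A COORDINATE-DIAGONAL LETTER**: if `T(f ⊗ E) = (η²Mf) ⊗ E` and `M ≺ C·L^{2n}·e^{−δd}` over the cube blocks, then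
`conj b T ≺ C·(Lⁿη)²·e^{−δd}`. [cite: Balaban1985BackgroundPropagators, Thm 3.1 (3.42)₁ p.397, Cor. 3.5 p.407, p.409 l.1–5; Balaban1984PropagatorsII, (2.51) p.232, Prop. 2.2 (2.67) p.234] -/
theorem h342_1_of_liftY (hT : ∀ (f : SiteY i → ℝ) (E : 𝔸), T (liftY f E) = liftY (((kGeo i).eta ^ 2) • (M *ᵥ f)) E) {C δ : ℝ} (Rr : ℝ) (H : Prop)
    (h₁ : HasMajorant (g := toB6 (geoCK i c) Rr H) (blkCubeY i c) (Matrix.toLin' M)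
      (fun y y' => C * ((ℓ : ℝ) + 1) ^ (2 * y.1.1) * Real.exp (-(δ * (geoCK i c).dist y y')))) :
    HasMajorant (g := toB6 (geoCK i c) Rr H) (fun p : SiteY i × ι => blkCubeY i c p.1) (conj b T)
      (fun a a' => C * (geoCK i c).len a ^ 2 * Real.exp (-(δ * (geoCK i c).dist a a'))) := by
  have hm := hasMajorant_smul (g := toB6 (geoCK i c) Rr H) (blkCubeY i c) h₁ ((kGeo i).eta ^ 2)
  refine hasMajorant_mono (g := toB6 (geoCK i c) Rr H) _ (hasMajorant_conj_of_liftY b (g := toB6 (geoCK i c) Rr H) (blkCubeY i c) _ _ (fun f E => ?_) hm) fun a a' => ?_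
  · rw [hT, LinearMap.smul_apply, Matrix.toLin'_apply]
  · exact ((len_reshape i c C δ a a').1).le

/-- ★ **BINDER `h342_2`, FORWARD BONDS** (`k = inl μ`): `∂_μ·M ≺ C·Lⁿ·e^{−δd}` gives `conj b(∇_μ)·conj b T ≺ C·(Lⁿη)·e^{−δd}`.
[cite: Balaban1985BackgroundPropagators, Thm 3.1 (3.42)₂ p.397, Cor. 3.5 p.407, p.409; Balaban1984PropagatorsII, Prop. 2.2 (2.67)₂ p.234] -/
theorem h342_2_inl_of_liftY (hT : ∀ (f : SiteY i → ℝ) (E : 𝔸), T (liftY f E) = liftY (((kGeo i).eta ^ 2) • (M *ᵥ f)) E) {C δ : ℝ} (Rr : ℝ) (H : Prop)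
    (μ : Fin (d + 1))
    (h₂ : HasMajorant (g := toB6 (geoCK i c) Rr H) (blkCubeY i c) (Matrix.toLin' (dT (toKT i).NB μ * M))
      (fun y y' => C * ((ℓ : ℝ) + 1) ^ y.1.1 * Real.exp (-(δ * (geoCK i c).dist y y')))) :
    HasMajorant (g := toB6 (geoCK i c) Rr H) (fun p : SiteY i × ι => blkCubeY i c p.1)
      (conj b (diffLetter (shiftY i) (fun _ _ => (1 : 𝔸ˣ)) ((((geoCK i c).eta : ℂ))⁻¹) (Sum.inl μ)) * conj b T)
      (fun a a' => C * (geoCK i c).len a * Real.exp (-(δ * (geoCK i c).dist a a'))) := by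
  have hη := eta_ne_zero i
  have hm := hasMajorant_smul (g := toB6 (geoCK i c) Rr H) (blkCubeY i c) h₂ ((kGeo i).eta)
  rw [diffLetter_inl, ← B9Eq352DivFormLetters.conj_mul, geoCK_eta]
  refine hasMajorant_mono (g := toB6 (geoCK i c) Rr H) _ (hasMajorant_conj_of_liftY b (g := toB6 (geoCK i c) Rr H) (blkCubeY i c) _ _ (fun f E => ?_) hm) fun a a' => ?_
  · rw [Module.End.mul_apply, hT, gradLetterF_one_liftY, LinearMap.smul_apply, Matrix.toLin'_apply, Matrix.mulVec_smul, smul_smul, ← Matrix.mulVec_mulVec]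
    congr 1
    rw [show (kGeo i).eta⁻¹ * (kGeo i).eta ^ 2 = (kGeo i).eta by field_simp]
  · exact ((len_reshape i c C δ a a').2).le

/-- ★ **BINDER `h342_3`, BACKWARD BONDS** (`k = inr μ`): `M·∂_μᵀ ≺ C·Lⁿ·e^{−δd}` gives `conj b T·conj b(−∇*_μ) ≺ C·(Lⁿη)·e^{−δd}`.
[cite: Balaban1985BackgroundPropagators, Thm 3.1 (3.42)₃ p.397, Cor. 3.5 p.407, p.409; Balaban1984PropagatorsII, Prop. 2.2 (2.67)₃ p.234] -/
theorem h342_3_inr_of_liftY (hT : ∀ (f : SiteY i → ℝ) (E : 𝔸), T (liftY f E) = liftY (((kGeo i).eta ^ 2) • (M *ᵥ f)) E) {C δ : ℝ} (Rr : ℝ) (H : Prop)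
    (μ : Fin (d + 1))
    (h₃ : HasMajorant (g := toB6 (geoCK i c) Rr H) (blkCubeY i c) (Matrix.toLin' (M * (dT (toKT i).NB μ)ᵀ))
      (fun y y' => C * ((ℓ : ℝ) + 1) ^ y.1.1 * Real.exp (-(δ * (geoCK i c).dist y y')))) :
    HasMajorant (g := toB6 (geoCK i c) Rr H) (fun p : SiteY i × ι => blkCubeY i c p.1)
      (conj b T * conj b (diffLetter (shiftY i) (fun _ _ => (1 : 𝔸ˣ)) ((((geoCK i c).eta : ℂ))⁻¹) (Sum.inr μ)))
      (fun a a' => C * (geoCK i c).len a * Real.exp (-(δ * (geoCK i c).dist a a'))) := by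
  have hη := eta_ne_zero i
  have hm := hasMajorant_neg (g := toB6 (geoCK i c) Rr H) (blkCubeY i c) (hasMajorant_smul (g := toB6 (geoCK i c) Rr H) (blkCubeY i c) h₃ ((kGeo i).eta))
  rw [diffLetter_inr, ← B9Eq352DivFormLetters.conj_mul, geoCK_eta]
  refine hasMajorant_mono (g := toB6 (geoCK i c) Rr H) _ (hasMajorant_conj_of_liftY b (g := toB6 (geoCK i c) Rr H) (blkCubeY i c) _ _ (fun f E => ?_) hm) fun a a' => ?_
  · rw [Module.End.mul_apply, LinearMap.neg_apply, gradLetterB_one_liftY, map_neg, hT, ← liftY_neg, LinearMap.neg_apply, LinearMap.smul_apply,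
      Matrix.toLin'_apply, Matrix.mulVec_smul, smul_smul, ← Matrix.mulVec_mulVec]
    congr 2
    rw [show (kGeo i).eta ^ 2 * (kGeo i).eta⁻¹ = (kGeo i).eta by field_simp]
  · exact ((len_reshape i c C δ a a').2).le

/-- **BINDER `h342_2`, BACKWARD BONDS** (`k = inr μ`: `∇*_μ·G′`): `∂_μᵀ·M ≺ C·Lⁿ·e^{−δd}` gives `conj b(−∇*_μ)·conj b T ≺ C·(Lⁿη)·e^{−δd}`.
[cite: Balaban1985BackgroundPropagators, Thm 3.1 (3.42) p.397 (∇_U both orientations, (3.3)/(3.8)), Cor. 3.5 p.407, p.409] -/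
theorem h342_2_inr_of_liftY (hT : ∀ (f : SiteY i → ℝ) (E : 𝔸), T (liftY f E) = liftY (((kGeo i).eta ^ 2) • (M *ᵥ f)) E) {C δ : ℝ} (Rr : ℝ) (H : Prop)
    (μ : Fin (d + 1))
    (h₂' : HasMajorant (g := toB6 (geoCK i c) Rr H) (blkCubeY i c) (Matrix.toLin' ((dT (toKT i).NB μ)ᵀ * M))
      (fun y y' => C * ((ℓ : ℝ) + 1) ^ y.1.1 * Real.exp (-(δ * (geoCK i c).dist y y')))) :
    HasMajorant (g := toB6 (geoCK i c) Rr H) (fun p : SiteY i × ι => blkCubeY i c p.1)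
      (conj b (diffLetter (shiftY i) (fun _ _ => (1 : 𝔸ˣ)) ((((geoCK i c).eta : ℂ))⁻¹) (Sum.inr μ)) * conj b T)
      (fun a a' => C * (geoCK i c).len a * Real.exp (-(δ * (geoCK i c).dist a a'))) := by
  have hη := eta_ne_zero i
  have hm := hasMajorant_neg (g := toB6 (geoCK i c) Rr H) (blkCubeY i c) (hasMajorant_smul (g := toB6 (geoCK i c) Rr H) (blkCubeY i c) h₂' ((kGeo i).eta))
  rw [diffLetter_inr, ← B9Eq352DivFormLetters.conj_mul, geoCK_eta]
  refine hasMajorant_mono (g := toB6 (geoCK i c) Rr H) _ (hasMajorant_conj_of_liftY b (g := toB6 (geoCK i c) Rr H) (blkCubeY i c) _ _ (fun f E => ?_) hm) fun a a' => ?_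
  · rw [Module.End.mul_apply, hT, LinearMap.neg_apply, gradLetterB_one_liftY, ← liftY_neg, LinearMap.neg_apply, LinearMap.smul_apply, Matrix.toLin'_apply,
      Matrix.mulVec_smul, smul_smul, ← Matrix.mulVec_mulVec]
    congr 2
    rw [show (kGeo i).eta⁻¹ * (kGeo i).eta ^ 2 = (kGeo i).eta by field_simp]
  · exact ((len_reshape i c C δ a a').2).le

/-- **BINDER `h342_3`, FORWARD BONDS** (`k = inl μ`: `G′·∇_μ`): `M·∂_μ ≺ C·Lⁿ·e^{−δd}` gives `conj b T·conj b(∇_μ) ≺ C·(Lⁿη)·e^{−δd}`.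
[cite: Balaban1985BackgroundPropagators, Thm 3.1 (3.42) p.397, Cor. 3.5 p.407, p.409] -/
theorem h342_3_inl_of_liftY (hT : ∀ (f : SiteY i → ℝ) (E : 𝔸), T (liftY f E) = liftY (((kGeo i).eta ^ 2) • (M *ᵥ f)) E) {C δ : ℝ} (Rr : ℝ) (H : Prop)
    (μ : Fin (d + 1))
    (h₃' : HasMajorant (g := toB6 (geoCK i c) Rr H) (blkCubeY i c) (Matrix.toLin' (M * dT (toKT i).NB μ))
      (fun y y' => C * ((ℓ : ℝ) + 1) ^ y.1.1 * Real.exp (-(δ * (geoCK i c).dist y y')))) :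
    HasMajorant (g := toB6 (geoCK i c) Rr H) (fun p : SiteY i × ι => blkCubeY i c p.1)
      (conj b T * conj b (diffLetter (shiftY i) (fun _ _ => (1 : 𝔸ˣ)) ((((geoCK i c).eta : ℂ))⁻¹) (Sum.inl μ)))
      (fun a a' => C * (geoCK i c).len a * Real.exp (-(δ * (geoCK i c).dist a a'))) := by
  have hη := eta_ne_zero i
  have hm := hasMajorant_smul (g := toB6 (geoCK i c) Rr H) (blkCubeY i c) h₃' ((kGeo i).eta)
  rw [diffLetter_inl, ← B9Eq352DivFormLetters.conj_mul, geoCK_eta]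
  refine hasMajorant_mono (g := toB6 (geoCK i c) Rr H) _ (hasMajorant_conj_of_liftY b (g := toB6 (geoCK i c) Rr H) (blkCubeY i c) _ _ (fun f E => ?_) hm) fun a a' => ?_
  · rw [Module.End.mul_apply, gradLetterF_one_liftY, hT, LinearMap.smul_apply, Matrix.toLin'_apply, Matrix.mulVec_smul, smul_smul, ← Matrix.mulVec_mulVec]
    congr 1
    rw [show (kGeo i).eta ^ 2 * (kGeo i).eta⁻¹ = (kGeo i).eta by field_simp]
  · exact ((len_reshape i c C δ a a').2).le

/-- **THE BACKWARD-LEFT ENTRY `∂_μᵀ·M` FROM THE FORWARD-LEFT ONE** for any real matrix `M` (FILE 5b's one-step shift, generic edition): with the scale transfer of `Lⁿ`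
at `(δ, α, Λ)`, triangle and (2.61) at `((1−α)δ, α′)`, `∂_μᵀ·M ≺ (e^{δ}·C·Λ·c₁²)·Lⁿ·e^{−(1−α′)(1−α)δd}`.
[cite: Balaban1985BackgroundPropagators, Thm 3.1 (3.42) p.397 (∇_U, (3.3)/(3.8)), Cor. 3.5 p.407, p.398 (scale transfer); Balaban1984PropagatorsII, Prop. 2.2 (2.67)₂ p.234, (2.52)–(2.63) pp.232–234] -/
theorem hasMajorant_transpose_dT_mul (Rr : ℝ) (H : Prop) (dB : ℕ) {C δ α α' Λ : ℝ} (hC : 0 ≤ C) (hδ : 0 ≤ δ) (hΛ : 0 ≤ Λ)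
    (hαδ : 0 ≤ α * δ) (hδ' : 0 ≤ (1 - α) * δ) (hα'1 : α' ≤ 1) (htri : B6RandomWalk.Triangle254 (toB6 (geoCK i c) Rr H))
    (hPΛ : ∀ a b : BlkCubeY i c, Real.exp (-(α * δ * (geoCK i c).dist a b)) * ((ℓ : ℝ) + 1) ^ b.1.1 ≤ Λ * ((ℓ : ℝ) + 1) ^ a.1.1)
    (h261 : B6RandomWalk.Ineq261 dB (toB6 (geoCK i c) Rr H) ((1 - α) * δ) α') (μ : Fin (d + 1))
    (h₂ : HasMajorant (g := toB6 (geoCK i c) Rr H) (blkCubeY i c) (Matrix.toLin' (dT (toKT i).NB μ * M))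
      (fun y y' => C * ((ℓ : ℝ) + 1) ^ y.1.1 * Real.exp (-(δ * (geoCK i c).dist y y')))) :
    HasMajorant (g := toB6 (geoCK i c) Rr H) (blkCubeY i c) (Matrix.toLin' ((dT (toKT i).NB μ)ᵀ * M))
      (fun y y' => Real.exp δ * C * Λ * B6.c1 dB ((1 - α) * δ) α' ^ 2 * ((ℓ : ℝ) + 1) ^ y.1.1 *
        Real.exp (-((1 - α') * ((1 - α) * δ) * (geoCK i c).dist y y'))) := by
  rw [toLin'_transpose_dT_mul]
  exact hasMajorant_shift_mul_weighted i c Rr H (blkCubeY i c) dB (fun a : BlkCubeY i c => ((ℓ : ℝ) + 1) ^ a.1.1) (Real.exp_nonneg δ) hC hΛ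
    (fun a => by positivity) hαδ hδ' hα'1 htri hPΛ h261 (hasMajorant_shiftMat i c Rr H hδ μ (-1) (Or.inr rfl))
    (hasMajorant_neg (g := toB6 (geoCK i c) Rr H) (blkCubeY i c) h₂)

/-- **THE FORWARD-RIGHT ENTRY `M·∂_μ` FROM THE BACKWARD-RIGHT ONE** for any real matrix `M` (generic edition of FILE 5b's): with triangle and (2.61) at `(δ, α)`,
`M·∂_μ ≺ (C·c₁·e^{(1−α)δ})·Lⁿ·e^{−(1−α)δd}`. [cite: Balaban1985BackgroundPropagators, Thm 3.1 (3.42) p.397, Cor. 3.5 p.407; Balaban1984PropagatorsII, Prop. 2.2 (2.67)₃ p.234, (2.65) p.234, (2.52)–(2.55) pp.232–233] -/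
theorem hasMajorant_mul_dT (Rr : ℝ) (H : Prop) (dB : ℕ) {C δ α : ℝ} (hC : 0 ≤ C) (hδ' : 0 ≤ (1 - α) * δ)
    (htri : B6RandomWalk.Triangle254 (toB6 (geoCK i c) Rr H)) (h261 : B6RandomWalk.Ineq261 dB (toB6 (geoCK i c) Rr H) δ α) (μ : Fin (d + 1))
    (h₃ : HasMajorant (g := toB6 (geoCK i c) Rr H) (blkCubeY i c) (Matrix.toLin' (M * (dT (toKT i).NB μ)ᵀ))
      (fun y y' => C * ((ℓ : ℝ) + 1) ^ y.1.1 * Real.exp (-(δ * (geoCK i c).dist y y')))) :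
    HasMajorant (g := toB6 (geoCK i c) Rr H) (blkCubeY i c) (Matrix.toLin' (M * dT (toKT i).NB μ))
      (fun y y' => C * B6.c1 dB δ α * ((ℓ : ℝ) + 1) ^ y.1.1 * Real.exp ((1 - α) * δ) * Real.exp (-((1 - α) * δ * (geoCK i c).dist y y'))) := by
  rw [toLin'_mul_dT]
  exact B6RandomWalk.majorant_G0_mul_265 (g := toB6 (geoCK i c) Rr H) (blkCubeY i c) dB δ α C (Real.exp ((1 - α) * δ))
    (fun a : BlkCubeY i c => ((ℓ : ℝ) + 1) ^ a.1.1) hC (fun a => by positivity) (Real.exp_nonneg _) hδ' htri h261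
    (hasMajorant_neg (g := toB6 (geoCK i c) Rr H) (blkCubeY i c) h₃) (hasMajorant_shiftMat i c Rr H hδ' μ 1 (Or.inl rfl))

end Generic

/-! ## §2  The padded Dirichlet letters at `U = 1`: `Δp = conj b(η⁻²·padΔ_{□,Ω₀}(1))`, `Gp = conj b(η²·(padΔ_{□,Ω₀}(1))⁻¹)`, their laws and the matrix clause -/

section Letters

variable {𝔸 : Type} [NormedRing 𝔸] [NormedAlgebra ℂ 𝔸] [CompleteSpace 𝔸]
variable {ι : Type} [Fintype ι] (b : Module.Basis ι ℝ 𝔸)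
variable (i : KIdx d ℓ hd hL b₀ b₁) (c : ↥(cubes (toKT i).D.toDomains)) (par : SiteParY 𝔸 i)

/-- **`Ω₀(□)` AT def-Y's MEMBER**: the Dirichlet domain of the cube sequence (g31's `dirDomC`, the embedded open mirror box ⊇ `C₁(□)`).
[cite: Balaban1985BackgroundPropagators, p.408 («Ω₀(□) ⊂ □⁵»), p.394 («Ω₀»)] -/
abbrev dirDomY : Finset (SiteY i) := dirDomC (toKT i).D c (toKT i).hMh (toKT i).hP

/-- **`G′_□(1)` AS A REAL KERNEL AT def-Y's MEMBER** (g31's `GpDirOne`, zero off `Ω₀(□) × Ω₀(□)`). [cite: Balaban1985BackgroundPropagators, p.394, p.409 («G′_□(U)»)] -/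
abbrev GpDirOneY : Matrix (SiteY i) (SiteY i) ℝ := GpDirOne (toKT i).D c hL.1 (oddMh i) (toKT i).hMh (toKT i).hP

/-- **THE PADDED DIRICHLET KERNEL `𝟙_{Ω₀}G′_□(1)𝟙_{Ω₀} + (1 − 𝟙_{Ω₀})`** — the real matrix of `(padΔ_{□,Ω₀}(1))⁻¹` (the identity on the exterior rows).
[cite: Balaban1985BackgroundPropagators, p.394 («Δ′_a↾Ω₀ = Ω₀Δ′_aΩ₀ … Its inverse is denoted by G′»), p.409; Balaban1983RegularityDecay, (2.42) p.584] -/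
def GpDirPadW : Matrix (SiteY i) (SiteY i) ℝ := dirPadY (indDiagY (dirDomY i c)) (GpDirOneY i c)

/-- **the letter `Δp = η⁻²·padΔ_{□,Ω₀}(1)`** of `thm34_Gp_uniform` at the Dirichlet cube, print's units, real coordinates.
[cite: Balaban1985BackgroundPropagators, (3.24) p.394, p.394 («Ω₀Δ′_aΩ₀»), p.409, Cor. 3.5 p.407 (U = 1)] -/
def DpDirK : Module.End ℝ (SiteY i × ι → ℝ) :=
  conj b (((kGeo i).eta ^ 2)⁻¹ • (padDeltaCubeY i c par (dirDomY i c) (fun _ _ => 1)).restrictScalars ℝ)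

/-- **the letter `Gp = η²·(padΔ_{□,Ω₀}(1))⁻¹`** of `thm34_Gp_uniform` at the Dirichlet cube (`Ring.inverse`), print's units, real coordinates; its compression
`Ω₀·Gp·Ω₀` is def-Y's `G′_□(1) = GpDirY … Ω₀(□) 1` (`GpDirY_def`). [cite: Balaban1985BackgroundPropagators, (3.25) p.395, p.394, p.409 («G′_□(U)»), Cor. 3.5 p.407] -/
def GpDirK : Module.End ℝ (SiteY i × ι → ℝ) :=
  conj b (((kGeo i).eta ^ 2) • (Ring.inverse (padDeltaCubeY i c par (dirDomY i c) (fun _ _ => 1))).restrictScalars ℝ)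

/-- ★ **THE REGIME AT `U = 1`**: `padΔ_{□,Ω₀}(1)` is a unit (E's `isUnit_padDeltaCubeY_one` fed by g31's `compress_mul_GpDirOneY`), any transporter letter with `par 1 = 1`.
[cite: Balaban1985BackgroundPropagators, p.394 («Its inverse is denoted by G′»), Cor. 3.5 p.407; Balaban1983RegularityDecay, (2.42) p.584] -/
theorem isUnit_padDeltaCubeY_one_dirDomY (hpar : ∀ z w, par (fun _ _ => 1) z w = 1) :
    IsUnit (padDeltaCubeY i c par (dirDomY i c) (fun _ _ => (1 : 𝔸ˣ))) :=
  isUnit_padDeltaCubeY_one i c par hpar (dirDomY i c) (compress_mul_GpDirOneY i c)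

/-- ★ **THE BINDERS `hΔpGp`, `hGpΔp` AT THE DIRICHLET CUBE**: `Δp·Gp = 1 = Gp·Δp` at `U = 1`.
[cite: Balaban1985BackgroundPropagators, (3.24)–(3.25) pp.394–395, Cor. 3.5 p.407, p.409] -/
theorem DpDirK_mul_GpDirK (hpar : ∀ z w, par (fun _ _ => 1) z w = 1) :
    DpDirK b i c par * GpDirK b i c par = 1 ∧ GpDirK b i c par * DpDirK b i c par = 1 := by
  have hη2 : ((kGeo i).eta ^ 2 : ℝ) ≠ 0 := pow_ne_zero 2 (eta_ne_zero i)
  have hunit := isUnit_padDeltaCubeY_one_dirDomY i c par hpar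
  constructor
  · rw [DpDirK, GpDirK, ← B9Eq352DivFormLetters.conj_mul, smul_mul_smul_comm, inv_mul_cancel₀ hη2, one_smul, Module.End.mul_eq_comp,
      ← LinearMap.restrictScalars_comp, ← Module.End.mul_eq_comp, Ring.mul_inverse_cancel _ hunit]
    exact conj_one' b
  · rw [DpDirK, GpDirK, ← B9Eq352DivFormLetters.conj_mul, smul_mul_smul_comm, mul_inv_cancel₀ hη2, one_smul, Module.End.mul_eq_comp,
      ← LinearMap.restrictScalars_comp, ← Module.End.mul_eq_comp, Ring.inverse_mul_cancel _ hunit]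
    exact conj_one' b

/-- ★ **THE MATRIX CLAUSE OF `(padΔ_{□,Ω₀}(1))⁻¹`**: `(padΔ_{□,Ω₀}(1))⁻¹ = (𝟙G′_□(1)𝟙 + 1 − 𝟙)♯` (E's `padDeltaCubeY_one_liftY` + `dirPadY_mul_dirPadY_eq_one` +
g31's `compress_mul_GpDirOneY`). [cite: Balaban1985BackgroundPropagators, p.394, Cor. 3.5 p.407, p.409; Balaban1983RegularityDecay, (2.42) p.584] -/
theorem ringInverse_padDeltaCubeY_one_eq_liftOpY (hpar : ∀ z w, par (fun _ _ => 1) z w = 1) :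
    Ring.inverse (padDeltaCubeY i c par (dirDomY i c) (fun _ _ => (1 : 𝔸ˣ))) = liftOpY 𝔸 (GpDirPadW i c) :=
  eq_liftOpY_of_ringInverse rfl
    (dirPadY_mul_dirPadY_eq_one (indDiagY_mul_indDiagY (dirDomY i c)) (compr_mul_compr_eq_indDiagY (dirDomY i c) (compress_mul_GpDirOneY i c)))
    (padDeltaCubeY_one_liftY i c par hpar (dirDomY i c))

/-- hence `η²(padΔ_{□,Ω₀}(1))⁻¹(f ⊗ E) = (η²·GpDirPadW f) ⊗ E` — the `hT` clause of §1 for the letter `GpDirK`. [cite: Balaban1985BackgroundPropagators, Cor. 3.5 p.407, p.409] -/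
theorem smul_ringInverse_padDeltaCubeY_one_liftY (hpar : ∀ z w, par (fun _ _ => 1) z w = 1) (f : SiteY i → ℝ) (E : 𝔸) :
    (((kGeo i).eta ^ 2) • (Ring.inverse (padDeltaCubeY i c par (dirDomY i c) (fun _ _ => 1))).restrictScalars ℝ) (liftY f E) =
      liftY (((kGeo i).eta ^ 2) • (GpDirPadW i c *ᵥ f)) E := by
  rw [LinearMap.smul_apply, LinearMap.restrictScalars_apply, ringInverse_padDeltaCubeY_one_eq_liftOpY i c par hpar, liftOpY_liftY, liftY_smul]

/-- `G′_□(1)` vanishes off `Ω₀(□) × Ω₀(□)`: `𝟙_{Ω₀}·GpDirOne·𝟙_{Ω₀} = GpDirOne`. [cite: Balaban1985BackgroundPropagators, p.394 (Dirichlet rows and columns), bookkeeping] -/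
theorem compr_GpDirOneY : indDiagY (dirDomY i c) * GpDirOneY i c * indDiagY (dirDomY i c) = GpDirOneY i c := by
  ext z w
  rw [compr_apply]
  split_ifs with h
  · rfl
  · rcases not_and_or.1 h with hz | hw
    · exact (GpDirOne_apply_of_not_mem_left hz w).symm
    · exact (GpDirOne_apply_of_not_mem_right z hw).symm

/-- ★ **THE SPLIT `GpDirPadW = GpDirOne + (1 − 𝟙_{Ω₀})`** (interior kernel + identity on the exterior rows). [cite: Balaban1985BackgroundPropagators, p.394 («Ω₀Δ′_aΩ₀»), bookkeeping] -/
theorem GpDirPadW_eq_add : GpDirPadW i c = GpDirOneY i c + (1 - indDiagY (dirDomY i c)) := by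
  rw [GpDirPadW, dirPadY, compr_GpDirOneY]

/-- ★ **def-Y's `G′_□(1)` IS THE COMPRESSION OF THE PADDED LETTER**: `GpDirY i □ par Ω₀(□) 1 = (𝟙·GpDirPadW·𝟙)♯ = GpDirOne♯`.
[cite: Balaban1985BackgroundPropagators, p.394 («Its inverse is denoted by G′»), p.409 («G′_□(U)»), Cor. 3.5 p.407] -/
theorem GpDirY_one_eq_liftOpY_GpDirOneY (hpar : ∀ z w, par (fun _ _ => 1) z w = 1) :
    GpDirY i c par (dirDomY i c) (fun _ _ => 1) = liftOpY 𝔸 (GpDirOneY i c) := by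
  rw [GpDirY_one_eq_liftOpY i c par hpar (dirDomY i c) (compress_mul_GpDirOneY i c), compr_GpDirOneY]

end Letters

/-! ## §3  The exterior rows: block majorants of `1 − 𝟙_S` and of its four one-step products (no geometry of `S` enters) -/

section Compl

variable (i : KIdx d ℓ hd hL b₀ b₁) (c : ↥(cubes (toKT i).D.toDomains))

/-- **POINTWISE DOMINATION ONE STENCIL STEP AWAY GIVES A BLOCK MAJORANT**: if `|(Tf)(z)| ≤ |f(σz)|` with `d(B(z), B(σz)) ≤ 1`, then
`T ≺ C·w·e^{−δd}` whenever `e^{δ} ≤ C` and `1 ≤ w`. [cite: Balaban1984PropagatorsII, (2.51) p.232, (2.54) p.233, bookkeeping] -/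
theorem hasMajorant_of_pointwise_le (Rr : ℝ) (H : Prop) {T : Module.End ℝ (SiteY i → ℝ)} (σ : SiteY i → SiteY i)
    (hT : ∀ (f : SiteY i → ℝ) (z : SiteY i), |T f z| ≤ |f (σ z)|)
    (hσ : ∀ z, (geoCK i c).dist (blkCubeY i c z) (blkCubeY i c (σ z)) ≤ 1) {C δ : ℝ} (hδ : 0 ≤ δ) (hC : Real.exp δ ≤ C)
    (w : BlkCubeY i c → ℝ) (hw : ∀ a, 1 ≤ w a) :
    HasMajorant (g := toB6 (geoCK i c) Rr H) (blkCubeY i c) T (fun a a' => C * w a * Real.exp (-(δ * (geoCK i c).dist a a'))) := by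
  have hC0 : 0 ≤ C := (Real.exp_pos δ).le.trans hC
  intro y' μ B hμ z
  have hK0 : 0 ≤ C * w (blkCubeY i c z) * Real.exp (-(δ * (geoCK i c).dist (blkCubeY i c z) y')) :=
    mul_nonneg (mul_nonneg hC0 (zero_le_one.trans (hw _))) (Real.exp_pos _).le
  by_cases hz : blkCubeY i c (σ z) = y'
  · have hd : (geoCK i c).dist (blkCubeY i c z) y' ≤ 1 := hz ▸ hσ z
    have hdd : δ * (geoCK i c).dist (blkCubeY i c z) y' ≤ δ := by
      have := mul_le_mul_of_nonneg_left hd hδ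
      rwa [mul_one] at this
    have hexp : Real.exp (-δ) ≤ Real.exp (-(δ * (geoCK i c).dist (blkCubeY i c z) y')) := Real.exp_le_exp.2 (by linarith)
    have h1 : 1 ≤ C * w (blkCubeY i c z) * Real.exp (-(δ * (geoCK i c).dist (blkCubeY i c z) y')) :=
      calc (1 : ℝ) = Real.exp δ * 1 * Real.exp (-δ) := by rw [mul_one, ← Real.exp_add, add_neg_cancel, Real.exp_zero]
        _ ≤ C * w (blkCubeY i c z) * Real.exp (-(δ * (geoCK i c).dist (blkCubeY i c z) y')) :=
          mul_le_mul (mul_le_mul hC (hw _) zero_le_one hC0) hexp (Real.exp_pos _).le (mul_nonneg hC0 (zero_le_one.trans (hw _)))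
    calc |T μ z| ≤ |μ (σ z)| := hT μ z
      _ ≤ B := hμ.bound _ hz
      _ = 1 * B := (one_mul B).symm
      _ ≤ _ := mul_le_mul_of_nonneg_right h1 hμ.nonneg
  · calc |T μ z| ≤ |μ (σ z)| := hT μ z
      _ = 0 := by rw [hμ.off _ hz, abs_zero]
      _ ≤ _ := mul_nonneg hK0 hμ.nonneg

variable (S : Finset (SiteY i))

/-- `|((1 − 𝟙_S)f)(z)| ≤ |f(z)|`. [cite: Balaban1985BackgroundPropagators, p.394 («Ω₀ denotes a characteristic function»), bookkeeping] -/
theorem abs_compl_mulVec_le (f : SiteY i → ℝ) (z : SiteY i) : |((1 - indDiagY S : Matrix (SiteY i) (SiteY i) ℝ) *ᵥ f) z| ≤ |f z| := by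
  rw [Matrix.sub_mulVec, Pi.sub_apply, Matrix.one_mulVec, indDiagY_mulVec_apply]
  split_ifs <;> simp

/-- `((S_v·N)f)(z) = (Nf)(σ_v z)`. [cite: Balaban1983RegularityDecay, p.572 (periodic conditions), bookkeeping] -/
theorem shiftMat_mul_mulVec (v : Fin (d + 1) → ℤ) (N : Matrix (SiteY i) (SiteY i) ℝ) (f : SiteY i → ℝ) (z : SiteY i) :
    ((shiftMat (toKT i).NB v * N) *ᵥ f) z = (N *ᵥ f) (tshift (toKT i).NB v z) := by
  rw [← Matrix.mulVec_mulVec, shiftMat_mulVec]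

/-- `((N·S_v)f)(z) = (N(f ∘ σ_v))(z)` with `|((1 − 𝟙_S)·S_v f)(z)| ≤ |f(σ_v z)|`. [cite: Balaban1983RegularityDecay, p.572, bookkeeping] -/
theorem abs_compl_mul_shiftMat_mulVec_le (v : Fin (d + 1) → ℤ) (f : SiteY i → ℝ) (z : SiteY i) :
    |(((1 - indDiagY S : Matrix (SiteY i) (SiteY i) ℝ) * shiftMat (toKT i).NB v) *ᵥ f) z| ≤ |f (tshift (toKT i).NB v z)| := by
  rw [← Matrix.mulVec_mulVec]
  refine (abs_compl_mulVec_le i S _ z).trans ?_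
  rw [shiftMat_mulVec]

/-- `∂_μᵀ = S_{−e_μ} − 1`. [cite: Balaban1984PropagatorsII, (2.67) p.234 (∇*), dictionary] -/
theorem transpose_dT (μ : Fin (d + 1)) : (dT (toKT i).NB μ)ᵀ = shiftMat (toKT i).NB (-unitVec μ) - 1 := by
  rw [dT, Matrix.transpose_sub, Matrix.transpose_one, ← shiftMat_neg]

/-- `σ_{e_μ} = shiftY i μ` and `σ_{−e_μ} = (shiftY i μ)⁻¹`. [cite: Balaban1983RegularityDecay, p.572, dictionary] -/
theorem tshift_unitVec_eq (μ : Fin (d + 1)) (z : SiteY i) :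
    tshift (toKT i).NB (unitVec μ) z = shiftY i μ z ∧ tshift (toKT i).NB (-unitVec μ) z = (shiftY i μ).symm z :=
  ⟨rfl, (tshift_symm_apply _ _ _).symm⟩

/-- ★ **`1 − 𝟙_S ≺ C·w·e^{−δd}`** (`e^{δ} ≤ C`, `1 ≤ w`). [cite: Balaban1985BackgroundPropagators, p.394 («Ω₀Δ′_aΩ₀»); Balaban1984PropagatorsII, (2.51) p.232] -/
theorem hasMajorant_compl (Rr : ℝ) (H : Prop) {C δ : ℝ} (hδ : 0 ≤ δ) (hC : Real.exp δ ≤ C) (w : BlkCubeY i c → ℝ) (hw : ∀ a, 1 ≤ w a) :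
    HasMajorant (g := toB6 (geoCK i c) Rr H) (blkCubeY i c) (Matrix.toLin' (1 - indDiagY S : Matrix (SiteY i) (SiteY i) ℝ))
      (fun a a' => C * w a * Real.exp (-(δ * (geoCK i c).dist a a'))) :=
  hasMajorant_of_pointwise_le i c Rr H id (fun f z => by rw [Matrix.toLin'_apply]; exact abs_compl_mulVec_le i S f z)
    (fun z => (stencil_geoCK i c).2.2 _) hδ hC w hw

/-- the common final step: two majorants `C·w·e^{−δd}` of `T₁`, `T₂` give `2C·w·e^{−δd}` for `T₁ − T₂`. [cite: Balaban1984PropagatorsII, (2.52) p.232, bookkeeping] -/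
theorem hasMajorant_sub_two (Rr : ℝ) (H : Prop) {T₁ T₂ : Module.End ℝ (SiteY i → ℝ)} {C δ : ℝ} (w : BlkCubeY i c → ℝ)
    (h₁ : HasMajorant (g := toB6 (geoCK i c) Rr H) (blkCubeY i c) T₁ (fun a a' => C * w a * Real.exp (-(δ * (geoCK i c).dist a a'))))
    (h₂ : HasMajorant (g := toB6 (geoCK i c) Rr H) (blkCubeY i c) T₂ (fun a a' => C * w a * Real.exp (-(δ * (geoCK i c).dist a a')))) :
    HasMajorant (g := toB6 (geoCK i c) Rr H) (blkCubeY i c) (T₁ - T₂) (fun a a' => 2 * C * w a * Real.exp (-(δ * (geoCK i c).dist a a'))) := by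
  rw [sub_eq_add_neg]
  exact hasMajorant_mono (g := toB6 (geoCK i c) Rr H) _ (hasMajorant_add (g := toB6 (geoCK i c) Rr H) _ h₁
    (hasMajorant_neg (g := toB6 (geoCK i c) Rr H) (blkCubeY i c) h₂)) fun a a' => le_of_eq (by ring)

/-- ★ **`∂_μ·(1 − 𝟙_S) ≺ 2C·w·e^{−δd}`**. [cite: Balaban1985BackgroundPropagators, p.394, (3.3) p.390; Balaban1984PropagatorsII, (2.51)–(2.54) pp.232–233] -/
theorem hasMajorant_dT_mul_compl (Rr : ℝ) (H : Prop) {C δ : ℝ} (hδ : 0 ≤ δ) (hC : Real.exp δ ≤ C) (w : BlkCubeY i c → ℝ) (hw : ∀ a, 1 ≤ w a)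
    (μ : Fin (d + 1)) :
    HasMajorant (g := toB6 (geoCK i c) Rr H) (blkCubeY i c) (Matrix.toLin' (dT (toKT i).NB μ * (1 - indDiagY S : Matrix (SiteY i) (SiteY i) ℝ)))
      (fun a a' => 2 * C * w a * Real.exp (-(δ * (geoCK i c).dist a a'))) := by
  rw [dT, sub_mul, one_mul, map_sub]
  refine hasMajorant_sub_two i c Rr H w ?_ (hasMajorant_compl i c S Rr H hδ hC w hw)
  refine hasMajorant_of_pointwise_le i c Rr H (shiftY i μ) (fun f z => ?_) (fun z => (stencil_geoCK i c).2.1 μ z) hδ hC w hw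
  rw [Matrix.toLin'_apply, shiftMat_mul_mulVec, (tshift_unitVec_eq i μ z).1]
  exact abs_compl_mulVec_le i S f _

/-- ★ **`(1 − 𝟙_S)·∂_μᵀ ≺ 2C·w·e^{−δd}`**. [cite: Balaban1985BackgroundPropagators, p.394, (3.8) p.392; Balaban1984PropagatorsII, (2.51)–(2.54) pp.232–233] -/
theorem hasMajorant_compl_mul_transpose_dT (Rr : ℝ) (H : Prop) {C δ : ℝ} (hδ : 0 ≤ δ) (hC : Real.exp δ ≤ C) (w : BlkCubeY i c → ℝ)
    (hw : ∀ a, 1 ≤ w a) (μ : Fin (d + 1)) :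
    HasMajorant (g := toB6 (geoCK i c) Rr H) (blkCubeY i c) (Matrix.toLin' ((1 - indDiagY S : Matrix (SiteY i) (SiteY i) ℝ) * (dT (toKT i).NB μ)ᵀ))
      (fun a a' => 2 * C * w a * Real.exp (-(δ * (geoCK i c).dist a a'))) := by
  rw [transpose_dT, mul_sub, mul_one, map_sub]
  refine hasMajorant_sub_two i c Rr H w ?_ (hasMajorant_compl i c S Rr H hδ hC w hw)
  refine hasMajorant_of_pointwise_le i c Rr H (fun z => (shiftY i μ).symm z) (fun f z => ?_) (fun z => (stencil_geoCK i c).1 μ z) hδ hC w hw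
  rw [Matrix.toLin'_apply, ← (tshift_unitVec_eq i μ z).2]
  exact abs_compl_mul_shiftMat_mulVec_le i S _ f z

/-- ★ **`∂_μᵀ·(1 − 𝟙_S) ≺ 2C·w·e^{−δd}`**. [cite: Balaban1985BackgroundPropagators, p.394, (3.8) p.392; Balaban1984PropagatorsII, (2.51)–(2.54) pp.232–233] -/
theorem hasMajorant_transpose_dT_mul_compl (Rr : ℝ) (H : Prop) {C δ : ℝ} (hδ : 0 ≤ δ) (hC : Real.exp δ ≤ C) (w : BlkCubeY i c → ℝ)
    (hw : ∀ a, 1 ≤ w a) (μ : Fin (d + 1)) :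
    HasMajorant (g := toB6 (geoCK i c) Rr H) (blkCubeY i c) (Matrix.toLin' ((dT (toKT i).NB μ)ᵀ * (1 - indDiagY S : Matrix (SiteY i) (SiteY i) ℝ)))
      (fun a a' => 2 * C * w a * Real.exp (-(δ * (geoCK i c).dist a a'))) := by
  rw [transpose_dT, sub_mul, one_mul, map_sub]
  refine hasMajorant_sub_two i c Rr H w ?_ (hasMajorant_compl i c S Rr H hδ hC w hw)
  refine hasMajorant_of_pointwise_le i c Rr H (fun z => (shiftY i μ).symm z) (fun f z => ?_) (fun z => (stencil_geoCK i c).1 μ z) hδ hC w hw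
  rw [Matrix.toLin'_apply, shiftMat_mul_mulVec, (tshift_unitVec_eq i μ z).2]
  exact abs_compl_mulVec_le i S f _

/-- ★ **`(1 − 𝟙_S)·∂_μ ≺ 2C·w·e^{−δd}`**. [cite: Balaban1985BackgroundPropagators, p.394, (3.3) p.390; Balaban1984PropagatorsII, (2.51)–(2.54) pp.232–233] -/
theorem hasMajorant_compl_mul_dT (Rr : ℝ) (H : Prop) {C δ : ℝ} (hδ : 0 ≤ δ) (hC : Real.exp δ ≤ C) (w : BlkCubeY i c → ℝ) (hw : ∀ a, 1 ≤ w a)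
    (μ : Fin (d + 1)) :
    HasMajorant (g := toB6 (geoCK i c) Rr H) (blkCubeY i c) (Matrix.toLin' ((1 - indDiagY S : Matrix (SiteY i) (SiteY i) ℝ) * dT (toKT i).NB μ))
      (fun a a' => 2 * C * w a * Real.exp (-(δ * (geoCK i c).dist a a'))) := by
  rw [dT, mul_sub, mul_one, map_sub]
  refine hasMajorant_sub_two i c Rr H w ?_ (hasMajorant_compl i c S Rr H hδ hC w hw)
  refine hasMajorant_of_pointwise_le i c Rr H (shiftY i μ) (fun f z => ?_) (fun z => (stencil_geoCK i c).2.1 μ z) hδ hC w hw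
  rw [Matrix.toLin'_apply, ← (tshift_unitVec_eq i μ z).1]
  exact abs_compl_mul_shiftMat_mulVec_le i S _ f z

end Compl

/-! ## §4  ★★ Theorem 3.1 (3.42)₁₋₃ at `U = 1` for the PADDED Dirichlet kernel `GpDirPadW`, all bond orientations, one rate, one constant -/

section Merged

variable (i : KIdx d ℓ hd hL b₀ b₁) (c : ↥(cubes (toKT i).D.toDomains))

/-- ★★★ **THEOREM 3.1 (3.42)₁₋₃ AT `U = 1` FOR THE PADDED DIRICHLET CUBE KERNEL `𝟙G′_□(1)𝟙 + (1 − 𝟙)`, ALL BOND ORIENTATIONS, ONE RATE `δ₁` AND ONE CONSTANT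
`C₁` (functions of `d, L` only), UNIFORMLY IN THE MEMBER AND THE COVER CUBE** — g31's three printed orientations for `G′_□(1)` (`hasMajorant_GpDirOne`,
`hasMajorant_dT_GpDirOne`, `hasMajorant_GpDirOne_dTt`: [4] Prop. 2.2 at the reflected cube family folded by signed images) read over `toB6 (geoCK i □)`, the two
unprinted ones by the one-step shift (§1), plus the exterior rows (§3), above the member thresholds `M₀ ≤ L·M_h`, `N₀ + 1 ≤ R·L·M_h`, `T₀ ≤ R·L·M_h − 1`.
[cite: Balaban1985BackgroundPropagators, Thm 3.1 (3.42) p.397, Cor. 3.5 p.407, p.408 («Ω₀(□) ⊂ □⁵»), p.409 l.1–5, p.394, p.399 l.1–3; Balaban1984PropagatorsII, Prop. 2.2 (2.67) p.234, Lemma 2.1 p.234; Balaban1983RegularityDecay, (2.42) p.584] -/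
theorem thm31_dir_allOrientations (d ℓ : ℕ) (hℓ : 1 ≤ ℓ) :
    ∃ δ₁ C₁ M₀ T₀ : ℝ, ∃ N₀ : ℕ, 0 < δ₁ ∧ 0 < C₁ ∧
      ∀ {hd : 1 ≤ d + 1} {hL : Odd (ℓ + 1) ∧ 1 < ℓ + 1} {b₀ b₁ : ℝ} (i : KIdx d ℓ hd hL b₀ b₁) (c : ↥(cubes (toKT i).D.toDomains)) (Rr : ℝ) (H : Prop),
        M₀ ≤ ((ℓ : ℝ) + 1) * (toKT i).Mh → N₀ + 1 ≤ (toKT i).R * ((ℓ + 1) * (toKT i).Mh) → T₀ ≤ RM1 i →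
        HasMajorant (g := toB6 (geoCK i c) Rr H) (blkCubeY i c) (Matrix.toLin' (GpDirPadW i c))
            (fun y y' => C₁ * ((ℓ : ℝ) + 1) ^ (2 * y.1.1) * Real.exp (-(δ₁ * (geoCK i c).dist y y'))) ∧
        (∀ μ, HasMajorant (g := toB6 (geoCK i c) Rr H) (blkCubeY i c) (Matrix.toLin' (dT (toKT i).NB μ * GpDirPadW i c))
            (fun y y' => C₁ * ((ℓ : ℝ) + 1) ^ y.1.1 * Real.exp (-(δ₁ * (geoCK i c).dist y y')))) ∧
        (∀ μ, HasMajorant (g := toB6 (geoCK i c) Rr H) (blkCubeY i c) (Matrix.toLin' (GpDirPadW i c * (dT (toKT i).NB μ)ᵀ))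
            (fun y y' => C₁ * ((ℓ : ℝ) + 1) ^ y.1.1 * Real.exp (-(δ₁ * (geoCK i c).dist y y')))) ∧
        (∀ μ, HasMajorant (g := toB6 (geoCK i c) Rr H) (blkCubeY i c) (Matrix.toLin' ((dT (toKT i).NB μ)ᵀ * GpDirPadW i c))
            (fun y y' => C₁ * ((ℓ : ℝ) + 1) ^ y.1.1 * Real.exp (-(δ₁ * (geoCK i c).dist y y')))) ∧
        (∀ μ, HasMajorant (g := toB6 (geoCK i c) Rr H) (blkCubeY i c) (Matrix.toLin' (GpDirPadW i c * dT (toKT i).NB μ))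
            (fun y y' => C₁ * ((ℓ : ℝ) + 1) ^ y.1.1 * Real.exp (-(δ₁ * (geoCK i c).dist y y')))) := by
  obtain ⟨δa, Ca', Ma, Na, hδa, hCa', -, -, ha⟩ := hasMajorant_GpDirOne d ℓ hℓ
  obtain ⟨δb, Cb', Mb, Nb, hδb, hCb', -, -, hb⟩ := hasMajorant_dT_GpDirOne d ℓ hℓ
  obtain ⟨δc, Cc', Mc, Nc, hδc, hCc', -, -, hc⟩ := hasMajorant_GpDirOne_dTt d ℓ hℓ
  -- the signed-image constants `2^{d+1}·C`
  set Ca : ℝ := 2 ^ (d + 1) * Ca' with hCadef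
  set Cb : ℝ := 2 ^ (d + 1) * Cb' with hCbdef
  set Cc : ℝ := 2 ^ (d + 1) * Cc' with hCcdef
  have hCa : 0 < Ca := by positivity
  have hCb : 0 < Cb := by positivity
  have hCc : 0 < Cc := by positivity
  -- one base rate below the three printed ones
  set δ : ℝ := min δa (min δb δc) / 2 with hδdef
  have hδpos : 0 < δ := by rw [hδdef]; exact half_pos (lt_min hδa (lt_min hδb hδc))
  have hδa' : δ ≤ δa / 2 := by rw [hδdef]; linarith [min_le_left δa (min δb δc)]
  have hδb' : δ ≤ δb / 2 := by rw [hδdef]; linarith [min_le_right δa (min δb δc), min_le_left δb δc]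
  have hδc' : δ ≤ δc / 2 := by rw [hδdef]; linarith [min_le_right δa (min δb δc), min_le_right δb δc]
  -- (2.61) for the cube sequence at `(δ, 1/2)` (forward-right) and at `((1 − 1/2)δ, 1/2)` (backward-left)
  have hδh : 0 < (1 - 1 / 2) * δ := by linarith
  obtain ⟨dB₁, h261₁⟩ := exists_h261_geoCK d ℓ hδpos
  obtain ⟨dB₂, h261₂⟩ := exists_h261_geoCK d ℓ hδh
  -- constants
  set Λ : ℝ := ((ℓ : ℝ) + 1) ^ 4 with hΛdef
  have hΛ0 : 0 ≤ Λ := by positivity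
  set Cbl : ℝ := Real.exp δ * Cb * Λ * B6.c1 dB₂ ((1 - 1 / 2) * δ) (1 / 2) ^ 2 with hCbl
  set Cfr : ℝ := Cc * B6.c1 dB₁ δ (1 / 2) * Real.exp ((1 - 1 / 2) * δ) with hCfr
  have hCbl0 : 0 ≤ Cbl := by rw [hCbl]; exact mul_nonneg (mul_nonneg (mul_nonneg (Real.exp_nonneg _) hCb.le) hΛ0) (sq_nonneg _)
  have hCfr0 : 0 ≤ Cfr := by rw [hCfr]; exact mul_nonneg (mul_nonneg hCc.le (c1_nonneg _ _ _)) (Real.exp_nonneg _)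
  -- the exterior-row constant at the final rate `δ/4`
  set CE : ℝ := 2 * Real.exp (δ / 4) with hCE
  have hCE0 : 0 ≤ CE := by rw [hCE]; positivity
  set C₁ : ℝ := Ca + Cb + Cc + Cbl + Cfr with hC₁
  have hC₁pos : 0 < C₁ := by rw [hC₁]; linarith
  refine ⟨δ / 4, C₁ + CE, max Ma (max Mb Mc), 4 * Real.log ((ℓ : ℝ) + 1) / (9 / 5000 * δ),
    max (max Na (max Nb Nc)) (max (N1 d ℓ (9 / 5000 * δ)) (N1 d ℓ (9 / 5000 * ((1 - 1 / 2) * δ)))), by linarith, by linarith, ?_⟩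
  intro hd hL b₀ b₁ i c Rr H hM hN hT
  have h3 : 3 ≤ (toKT i).Mh := le_trans (by norm_num) i.hM8
  have hR := (toKT i).hR
  have hP4 := (toKT i).hP4
  -- unpack the thresholds
  have hMa : Ma ≤ ((ℓ : ℝ) + 1) * (toKT i).Mh := (le_max_left _ _).trans hM
  have hMb : Mb ≤ ((ℓ : ℝ) + 1) * (toKT i).Mh := ((le_max_left _ _).trans (le_max_right _ _)).trans hM
  have hMc : Mc ≤ ((ℓ : ℝ) + 1) * (toKT i).Mh := ((le_max_right _ _).trans (le_max_right _ _)).trans hM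
  have hNa : Na + 1 ≤ (toKT i).R * ((ℓ + 1) * (toKT i).Mh) :=
    le_trans (Nat.succ_le_succ ((le_max_left _ _).trans (le_max_left _ _))) hN
  have hNb : Nb + 1 ≤ (toKT i).R * ((ℓ + 1) * (toKT i).Mh) :=
    le_trans (Nat.succ_le_succ (((le_max_left _ _).trans (le_max_right _ _)).trans (le_max_left _ _))) hN
  have hNc : Nc + 1 ≤ (toKT i).R * ((ℓ + 1) * (toKT i).Mh) :=
    le_trans (Nat.succ_le_succ (((le_max_right _ _).trans (le_max_right _ _)).trans (le_max_left _ _))) hN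
  have hN1 : N1 d ℓ (9 / 5000 * δ) + 1 ≤ (toKT i).R * ((ℓ + 1) * (toKT i).Mh) :=
    le_trans (Nat.succ_le_succ ((le_max_left _ _).trans (le_max_right _ _))) hN
  have hN2 : N1 d ℓ (9 / 5000 * ((1 - 1 / 2) * δ)) + 1 ≤ (toKT i).R * ((ℓ + 1) * (toKT i).Mh) :=
    le_trans (Nat.succ_le_succ ((le_max_right _ _).trans (le_max_right _ _))) hN
  -- the three printed orientations for the interior kernel `GpDirOne`, read over `toB6 (geoCK i c)`
  have hdnn := (geoCK_dist_axioms i c Rr H).1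
  have htri := (geoCK_dist_axioms i c Rr H).2.1
  have hpow1 : ∀ a : BlkCubeY i c, 0 ≤ ((ℓ : ℝ) + 1) ^ a.1.1 := fun a => by positivity
  have hpow2 : ∀ a : BlkCubeY i c, 0 ≤ ((ℓ : ℝ) + 1) ^ (2 * a.1.1) := fun a => by positivity
  have hone1 : ∀ a : BlkCubeY i c, 1 ≤ ((ℓ : ℝ) + 1) ^ a.1.1 := fun a => one_le_pow₀ (by linarith [(Nat.cast_nonneg ℓ : (0 : ℝ) ≤ ℓ)])
  have hone2 : ∀ a : BlkCubeY i c, 1 ≤ ((ℓ : ℝ) + 1) ^ (2 * a.1.1) := fun a => one_le_pow₀ (by linarith [(Nat.cast_nonneg ℓ : (0 : ℝ) ≤ ℓ)])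
  have hA0 := hasMajorant_toB6_of_geomT i c Rr H (ha (toKT i).D c hL.1 (oddMh i) (toKT i).hMh (toKT i).hP h3 hMa hR hNa hP4)
  have hB0 := fun μ => hasMajorant_toB6_of_geomT i c Rr H (hb (toKT i).D c hL.1 (oddMh i) (toKT i).hMh (toKT i).hP h3 hMb hR hNb hP4 μ)
  have hC0 := fun μ => hasMajorant_toB6_of_geomT i c Rr H (hc (toKT i).D c hL.1 (oddMh i) (toKT i).hMh (toKT i).hP h3 hMc hR hNc hP4 μ)
  have hBδ : ∀ μ, HasMajorant (g := toB6 (geoCK i c) Rr H) (blkCubeY i c) (Matrix.toLin' (dT (toKT i).NB μ * GpDirOneY i c))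
      (fun y y' => Cb * ((ℓ : ℝ) + 1) ^ y.1.1 * Real.exp (-(δ * (geoCK i c).dist y y'))) :=
    fun μ => hasMajorant_weaken i c Rr H _ hpow1 le_rfl hCb.le hδb' (hB0 μ)
  have hCδ : ∀ μ, HasMajorant (g := toB6 (geoCK i c) Rr H) (blkCubeY i c) (Matrix.toLin' (GpDirOneY i c * (dT (toKT i).NB μ)ᵀ))
      (fun y y' => Cc * ((ℓ : ℝ) + 1) ^ y.1.1 * Real.exp (-(δ * (geoCK i c).dist y y'))) :=
    fun μ => hasMajorant_weaken i c Rr H _ hpow1 le_rfl hCc.le hδc' (hC0 μ)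
  -- the scale transfer of `Lⁿ` at `(δ, 1/2)` and (2.61) at the two pairs
  have hPΛ := transfer_pow_of_scaleTransfer i c ((hST_geoCK i c hδpos hT (1 / 2) (by norm_num)).1)
  have h261fr : Ineq261 dB₁ (toB6 (geoCK i c) Rr H) δ (1 / 2) := h261₁ i c Rr H hN1 (1 / 2) (by norm_num) (by norm_num)
  have h261bl : Ineq261 dB₂ (toB6 (geoCK i c) Rr H) ((1 - 1 / 2) * δ) (1 / 2) := h261₂ i c Rr H hN2 (1 / 2) (by norm_num) (by norm_num)
  -- the two unprinted orientations (§1, one-step shift)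
  have hBL : ∀ μ, HasMajorant (g := toB6 (geoCK i c) Rr H) (blkCubeY i c) (Matrix.toLin' ((dT (toKT i).NB μ)ᵀ * GpDirOneY i c))
      (fun y y' => Cbl * ((ℓ : ℝ) + 1) ^ y.1.1 * Real.exp (-((1 - 1 / 2) * ((1 - 1 / 2) * δ) * (geoCK i c).dist y y'))) :=
    fun μ => hasMajorant_transpose_dT_mul i c Rr H dB₂ hCb.le hδpos.le hΛ0 (by linarith) hδh.le (by norm_num) htri hPΛ h261bl μ (hBδ μ)
  have hFR : ∀ μ, HasMajorant (g := toB6 (geoCK i c) Rr H) (blkCubeY i c) (Matrix.toLin' (GpDirOneY i c * dT (toKT i).NB μ))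
      (fun y y' => Cfr * ((ℓ : ℝ) + 1) ^ y.1.1 * Real.exp (-((1 - 1 / 2) * δ * (geoCK i c).dist y y'))) := by
    intro μ
    refine hasMajorant_mono (g := toB6 (geoCK i c) Rr H) _ (hasMajorant_mul_dT i c Rr H dB₁ hCc.le hδh.le htri h261fr μ (hCδ μ)) fun a a' => ?_
    rw [hCfr]
    exact le_of_eq (by ring)
  -- collect at `(C₁, δ/4)` for the interior kernel
  have hle_a : Ca ≤ C₁ := by rw [hC₁]; linarith
  have hle_b : Cb ≤ C₁ := by rw [hC₁]; linarith
  have hle_c : Cc ≤ C₁ := by rw [hC₁]; linarith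
  have hle_bl : Cbl ≤ C₁ := by rw [hC₁]; linarith
  have hle_fr : Cfr ≤ C₁ := by rw [hC₁]; linarith
  have e1 := hasMajorant_weaken i c Rr H _ hpow2 hle_a hC₁pos.le (by linarith : δ / 4 ≤ δa / 2) hA0
  have e2 := fun μ => hasMajorant_weaken i c Rr H _ hpow1 hle_b hC₁pos.le (by linarith : δ / 4 ≤ δ) (hBδ μ)
  have e3 := fun μ => hasMajorant_weaken i c Rr H _ hpow1 hle_c hC₁pos.le (by linarith : δ / 4 ≤ δ) (hCδ μ)
  have e4 := fun μ => hasMajorant_weaken i c Rr H _ hpow1 hle_bl hC₁pos.le (by linarith : δ / 4 ≤ (1 - 1 / 2) * ((1 - 1 / 2) * δ)) (hBL μ)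
  have e5 := fun μ => hasMajorant_weaken i c Rr H _ hpow1 hle_fr hC₁pos.le (by linarith : δ / 4 ≤ (1 - 1 / 2) * δ) (hFR μ)
  -- the exterior rows at `(CE, δ/4)` (§3; `2·e^{δ/4}`)
  have hδ4 : 0 ≤ δ / 4 := by linarith
  have hexpCE : Real.exp (δ / 4) ≤ Real.exp (δ / 4) := le_rfl
  have f1 : HasMajorant (g := toB6 (geoCK i c) Rr H) (blkCubeY i c) (Matrix.toLin' (1 - indDiagY (dirDomY i c) : Matrix (SiteY i) (SiteY i) ℝ))
      (fun y y' => CE * ((ℓ : ℝ) + 1) ^ (2 * y.1.1) * Real.exp (-(δ / 4 * (geoCK i c).dist y y'))) :=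
    hasMajorant_mono (g := toB6 (geoCK i c) Rr H) _ (hasMajorant_compl i c (dirDomY i c) Rr H hδ4 hexpCE _ hone2) fun a a' => by
      rw [hCE]
      have : 0 ≤ Real.exp (δ / 4) * ((ℓ : ℝ) + 1) ^ (2 * a.1.1) * Real.exp (-(δ / 4 * (geoCK i c).dist a a')) :=
        mul_nonneg (mul_nonneg (Real.exp_nonneg _) (hpow2 a)) (Real.exp_nonneg _)
      linarith
  have f2 := fun μ => hasMajorant_dT_mul_compl i c (dirDomY i c) Rr H hδ4 hexpCE _ hone1 μ
  have f3 := fun μ => hasMajorant_compl_mul_transpose_dT i c (dirDomY i c) Rr H hδ4 hexpCE _ hone1 μ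
  have f4 := fun μ => hasMajorant_transpose_dT_mul_compl i c (dirDomY i c) Rr H hδ4 hexpCE _ hone1 μ
  have f5 := fun μ => hasMajorant_compl_mul_dT i c (dirDomY i c) Rr H hδ4 hexpCE _ hone1 μ
  -- interior + exterior
  refine ⟨?_, fun μ => ?_, fun μ => ?_, fun μ => ?_, fun μ => ?_⟩
  · rw [GpDirPadW_eq_add, map_add]
    exact hasMajorant_mono (g := toB6 (geoCK i c) Rr H) _ (hasMajorant_add (g := toB6 (geoCK i c) Rr H) _ e1 f1) fun a a' => le_of_eq (by ring)
  · rw [GpDirPadW_eq_add, mul_add, map_add]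
    exact hasMajorant_mono (g := toB6 (geoCK i c) Rr H) _ (hasMajorant_add (g := toB6 (geoCK i c) Rr H) _ (e2 μ) (f2 μ)) fun a a' =>
      le_of_eq (by rw [hCE]; ring)
  · rw [GpDirPadW_eq_add, add_mul, map_add]
    exact hasMajorant_mono (g := toB6 (geoCK i c) Rr H) _ (hasMajorant_add (g := toB6 (geoCK i c) Rr H) _ (e3 μ) (f3 μ)) fun a a' =>
      le_of_eq (by rw [hCE]; ring)
  · rw [GpDirPadW_eq_add, mul_add, map_add]
    exact hasMajorant_mono (g := toB6 (geoCK i c) Rr H) _ (hasMajorant_add (g := toB6 (geoCK i c) Rr H) _ (e4 μ) (f4 μ)) fun a a' =>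
      le_of_eq (by rw [hCE]; ring)
  · rw [GpDirPadW_eq_add, add_mul, map_add]
    exact hasMajorant_mono (g := toB6 (geoCK i c) Rr H) _ (hasMajorant_add (g := toB6 (geoCK i c) Rr H) _ (e5 μ) (f5 μ)) fun a a' =>
      le_of_eq (by rw [hCE]; ring)

end Merged

end Literature.MathematicalPhysics.QuantumFieldTheory.Balaban1983to89.B9Cor35GpDirInputsAtOne

end
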